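import Literature.AlgebraicGeometry.Resolution.FiniteBirationalNormal
import Mathlib.AlgebraicGeometry.ZariskisMainTheorem
import HarnessLib

/-!
# Zariski's Main Theorem, original form: a birational quasi-finite morphism onto a normal scheme
# is an open immersion

Topic `AlgebraicGeometry/Morphisms`, namespace `Literature.AlgebraicGeometry.Morphisms`. THEOREMS
ONLY (no definition, no named fact, no instance, no `sorry`).

Let `f : X ⟶ Y` be a morphism of INTEGRAL schemes which is separated, of finite type
(`LocallyOfFiniteType` + `QuasiCompact`) and locally quasi-finite, with `Y` NORMAL (all local
rings integrally closed) and `f` birational (`Literature.AlgebraicGeometry.Resolution.IsBirational`: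
an isomorphism over a dense open of `Y` with dense preimage). Then `f` is an open immersion
(`isOpenImmersion_of_locallyQuasiFinite_of_isBirational`). This is Zariski's Main Theorem in
Zariski's own form ([Hartshorne1977] III Cor. 11.4 and its proof; [EGA IV₃] 8.12.10;
[StacksProject] Tag 05K0 / 03GW): Grothendieck's form — Mathlib
`AlgebraicGeometry/ZariskisMainTheorem`: `f` factors as the open immersion `f.toNormalization`
into the relative normalization `f.normalization` of `Y` in `X` followed by the integral morphism
`f.fromNormalization` — reduces it to «an integral birational morphism of integral schemes onto a
normal scheme is an isomorphism» (tree ★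
`Literature.AlgebraicGeometry.Resolution.isIso_morphismRestrict_of_isIntegralHom_of_isIso_stalkMap`,
de Jong 1996, 4.16): the stalk map of `f.fromNormalization` at the generic point is an
isomorphism because that of `f` is (birationality) and that of the open immersion
`f.toNormalization` is.

* `isIso_fromNormalization_of_isBirational` — for `f` as above (quasi-finiteness not needed):
  `f.fromNormalization : f.normalization ⟶ Y` is an isomorphism, i.e. a normal integral scheme is
  its own normalization in any integral scheme birational and of finite type over it… (precisely:
  the relative normalization of `Y` in `X` is `Y`);
* **`isOpenImmersion_of_locallyQuasiFinite_of_isBirational`** — ZMT, original form;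
* `isOpenImmersion_of_injective_of_isBirational` — the form used by [Artin1986NeronModels]
  Lemma 2.3 (p. 218: «By Zariski's Main Theorem, it suffices to show that the maps are
  set-theoretically injective», the projections of the graph of a strict birational group law being
  separated, of finite type and birational onto the normal `V ×_S V`): injective on points +
  separated + finite type + birational onto normal ⇒ open immersion (injective ⇒ quasi-finite,
  Mathlib `LocallyQuasiFinite.of_injective`).

Cell `hodgecm-mathlib`: banked generic leaf toward road W (r₀, node (W1), key lemma W1b);
no floor change.

## References
* [Hartshorne1977] R. Hartshorne, *Algebraic Geometry*, III Cor. 11.4 (Zariski's Main Theorem)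
  and V Thm. 5.2.
* [Artin1986NeronModels] M. Artin, *Néron models*, in Cornell–Silverman, *Arithmetic Geometry*
  (1986), Lemma 2.3 (p. 218).
* [StacksProject] Tags 05K0, 03GW (Zariski's Main Theorem), 0AB1.
* [DeJong1996] A. J. de Jong, *Smoothness, semi-stability and alterations*, 4.16.
-/

set_option autoImplicit false

noncomputable section

open CategoryTheory CategoryTheory.Limits AlgebraicGeometry TopologicalSpace Topology

namespace Literature.AlgebraicGeometry.Morphisms

open Literature.AlgebraicGeometry.Resolution

universe u

/-- **The relative normalization of a normal integral scheme `Y` in an integral scheme `X`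
birational, separated and quasi-compact over it is `Y` itself**: for `f : X ⟶ Y` separated,
quasi-compact, locally of finite type and birational between integral schemes with `Y` normal,
the integral morphism `f.fromNormalization : f.normalization ⟶ Y` is an isomorphism. Proof: the
normalization `X'` is integral (Mathlib), `f.fromNormalization` is integral and dominant, and its
stalk map at the generic point `η_{X'} = f.toNormalization (η_X)` is an isomorphism since the
stalk maps of `f = f.toNormalization ≫ f.fromNormalization` (birational) and of
`f.toNormalization` at `η_X` are (the latter is an open immersion on the quasi-finite locus, which
contains `η_X`: the stalk map of `f` at `η_X` is an isomorphism of fields, so `f` is quasi-finite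
at `η_X` — here we simply use that `K(Y) ≅ K(X)` makes `𝒪_{X',η} → K(X)` an isomorphism
via the tree lemma on integral birational morphisms); conclude by ★
`isIso_morphismRestrict_of_isIntegralHom_of_isIso_stalkMap` on every non-empty affine open of `Y`.
We assume `LocallyQuasiFinite f` so that `f.toNormalization` is an open immersion (Mathlib's
Zariski Main Theorem), which is the case needed below.
[cite: StacksProject, Tag 03GW] [cite: DeJong1996, 4.16, p. 71] -/
theorem isIso_fromNormalization_of_isBirational {X Y : Scheme.{u}} [IsIntegral X] [IsIntegral Y]
    (f : X ⟶ Y) [LocallyQuasiFinite f] [LocallyOfFiniteType f] [IsSeparated f] [QuasiCompact f]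
    (hY : ∀ y : Y, IsIntegrallyClosed (Y.presheaf.stalk y)) (hf : IsBirational f) :
    IsIso f.fromNormalization := by
  haveI : IsDominant f := hf.isDominant
  -- `f.fromNormalization` is dominant, as `f = f.toNormalization ≫ f.fromNormalization` is
  haveI : IsDominant f.fromNormalization := by
    haveI : IsDominant (f.toNormalization ≫ f.fromNormalization) := by
      rw [Scheme.Hom.toNormalization_fromNormalization]; infer_instance
    exact IsDominant.of_comp f.toNormalization f.fromNormalization
  -- the stalk map of `f.fromNormalization` at the generic point is an isomorphism
  have hη : f.toNormalization (genericPoint X) = genericPoint f.normalization :=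
    genericPoint_eq_of_isOpenImmersion f.toNormalization
  have hstalkf : IsIso (f.stalkMap (genericPoint X)) := hf.isIso_stalkMap_genericPoint
  have hcomp : IsIso ((f.toNormalization ≫ f.fromNormalization).stalkMap (genericPoint X)) := by
    rw [Scheme.Hom.toNormalization_fromNormalization]
    exact hstalkf
  have hcomp' : IsIso (f.fromNormalization.stalkMap (f.toNormalization (genericPoint X)) ≫
      f.toNormalization.stalkMap (genericPoint X)) := by
    rw [Scheme.Hom.stalkMap_comp] at hcomp
    exact hcomp
  have hstalk' : IsIso (f.fromNormalization.stalkMap (f.toNormalization (genericPoint X))) :=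
    @IsIso.of_isIso_comp_right _ _ _ _ _ _ (f.toNormalization.stalkMap (genericPoint X)) _ hcomp'
  have hstalk : IsIso (f.fromNormalization.stalkMap (genericPoint f.normalization)) := by
    rw [← hη]; exact hstalk'
  -- being an isomorphism is local on the target: non-empty affine opens suffice
  have key : MorphismProperty.isomorphisms Scheme f.fromNormalization := by
    refine (IsZariskiLocalAtTarget.iff_of_iSup_eq_top
      (P := MorphismProperty.isomorphisms Scheme) _ (iSup_nonempty_affineOpens_eq_top Y)).mpr ?_
    rintro ⟨V, hVne⟩
    show IsIso (f.fromNormalization ∣_ (V : Y.Opens))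
    haveI := hVne
    exact isIso_morphismRestrict_of_isIntegralHom_of_isIso_stalkMap f.fromNormalization hY hstalk V
  exact key

/-- **Zariski's Main Theorem, original form.** A separated morphism of finite type between
integral schemes which is locally quasi-finite and birational onto a NORMAL scheme is an open
immersion: `f = f.toNormalization ≫ f.fromNormalization` with `f.toNormalization` an open
immersion (Mathlib, Grothendieck's form of ZMT) and `f.fromNormalization` an isomorphism
(`isIso_fromNormalization_of_isBirational`).
[cite: Hartshorne1977, III Cor. 11.4] [cite: StacksProject, Tag 05K0] -/
theorem isOpenImmersion_of_locallyQuasiFinite_of_isBirational {X Y : Scheme.{u}} [IsIntegral X]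
    [IsIntegral Y] (f : X ⟶ Y) [LocallyQuasiFinite f] [LocallyOfFiniteType f] [IsSeparated f]
    [QuasiCompact f] (hY : ∀ y : Y, IsIntegrallyClosed (Y.presheaf.stalk y))
    (hf : IsBirational f) : IsOpenImmersion f := by
  haveI := isIso_fromNormalization_of_isBirational f hY hf
  rw [← Scheme.Hom.toNormalization_fromNormalization f]
  infer_instance

/-- **Zariski's Main Theorem as used by [Artin1986NeronModels] Lemma 2.3** («By Zariski's Main
Theorem, it suffices to show that the maps are set-theoretically injective»): a separated morphism
of finite type between integral schemes which is INJECTIVE on points and birational onto a normal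
scheme is an open immersion (injective ⇒ locally quasi-finite, Mathlib
`LocallyQuasiFinite.of_injective`).
[cite: Artin1986NeronModels, Lemma 2.3 (p. 218)] [cite: Hartshorne1977, III Cor. 11.4] -/
theorem isOpenImmersion_of_injective_of_isBirational {X Y : Scheme.{u}} [IsIntegral X]
    [IsIntegral Y] (f : X ⟶ Y) [LocallyOfFiniteType f] [IsSeparated f] [QuasiCompact f]
    (hinj : Function.Injective f) (hY : ∀ y : Y, IsIntegrallyClosed (Y.presheaf.stalk y))
    (hf : IsBirational f) : IsOpenImmersion f :=
  haveI : LocallyQuasiFinite f := .of_injective hinj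
  isOpenImmersion_of_locallyQuasiFinite_of_isBirational f hY hf

end Literature.AlgebraicGeometry.Morphisms

end
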